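import Summits.QuantumFields.BalabanUV.T4Continuum.Support.NE9HoloFamilyOffCentre
import Summits.QuantumFields.BalabanUV.T4Continuum.Support.NE9HoloFamilyCoupledEndSharp2
import Summits.QuantumFields.BalabanUV.T4Continuum.Support.NE9FutureProfileEndOfRecordOffCentre

/-!
# NE9HoloFamilyOffCentreEnd — route R4♯-T AT THE RECORD: the ♯-END of record on the record's new-term shape with the
# TRANSLATION-AWARE chain — table half on `PotentialKPG` (KP for `m`, open ball), the (Φ-size) clause in OFF-CENTRE form
# (centre = slice of `explZ`, `‖·‖ ≤ p̄₀`; radius `2B`), rooms SPLIT as `ω̂·R₀ + τ̄·2B ≤ t·R₀`, `τ̄·p̄₀ ≤ c̄·R₀`, `c̄ + t = θ`,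
# conclusion at ANY rate `μ` passing the interval test (least such = the refuter's `λ* < θ`), prefactor `1∕(1−θ²)` unchanged

Cell `pub-balaban`, T4-DAG §6 NE9; BINDER row NE9 OWNER lineage `b2b-balaban-t4-ne9-p1` gen 62, CRUX PROVER NE9 (ruling e34b3e0c (2));
route R4 ∕ R4♯ ∕ R4♯-T of `t4/ROUTES-NE9.md` v9.0.1 (rank 1; refuter PRICING-NE9 v10 §E F-v10-4 ∕ Q-v10-1, v11).  THE OWNER's
RE-THREAD (K2 of CLAIMS.log 2026-08-21T10:0xZ «ONLINE gen 62»; item (β) of gen 61's HANDOFF) of route R4's record END E132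
`NE9HoloFamilyPotentialKPG` (p258235) §5∕§7 (coupling half `hlast` DISPLAYED, §1∕§3) and of E134 `NE9HoloFamilyCoupledEndSharp2`
(p259445) §1 (coupling half DERIVED on the inner ball, TWO RADII, §2∕§4) through the END of record's
translation-aware wrapper `NE9FutureProfileEndOfRecordOffCentre.ne9_and_fadingMemory_of_holoSlice_injRead_offCentre_split` ∕
`…_quadTest` (leaf lineage `…-leaf-05` gen 51, on (T-a) `NE9PolydiscChainOffCentre` (leaf-03 g44) ∘ (T-b) `NE9FutureProfileStepOffCentre`
(leaf-04 g50)), fed by the (T-c) RECORD CLAUSE `NE9HoloFamilyOffCentre.vacSlice_offCentre_of_potentialKPG` (this lineage, p260617):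
`cY k := holoSlice κ σ (explZ-family) k 0 0`, `‖cY k‖ ≤ p̄₀`, image of the table ball in `closedBall (cY k) (2B)`.

HONEST FRAMING (T4-DAG PAGE 1).  Rung (B)+1 of the FINITE-VOLUME T⁴ programme — NOT infinite volume, NOT a mass gap, NOT Clay.  NE9
(`T4OutputRate.NE9` ∧ `FadingMemory`) is a cell NEW ESTIMATE, NOT PRINTED in [I] = [Balaban1987RG1] (CMP **109**), [II] =
[Balaban1988RG2Cluster] (CMP **116**), NOT PROVED for Bałaban's E^{(j)}: every theorem below is «NE9 ⇐ the named binders»; the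
displayed Bałaban-side inputs are EXACTLY those of E132 §5 — `PotentialKPG W act m a d R₀` (= (R-0)[scope]
`NE9PencilScope238.PencilScope238`, displayed; TYPE [II] (2.14)∕(2.15) p. 15, (2.38) p. 20), `hdec`, `hpin`, `hΨv`∕`ΨOf`, `hexplZ`∕`hp₀`
(TYPE [I] (2.14) p. 268 ∕ [II] (2.41) p. 21), structural binders, `hlast` (displayed in §1∕§3; DERIVED in §2∕§4 from the coupling
two-point `hCup` + `hkp2` + the channel's modulus `hTcup` — NOT PRINTED as an inequality, [I] p. 263 «C^∞ … (or analytic)»), and the ROOM, now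
SPLIT — with ONE MORE displayed number, the rate `μ` subject to the interval test (a `norm_num` certificate at rational letters).  W1 =
model O-NE9-1 untouched; spine 0∕9.  HONEST DEPENDENCY (cell line, verbatim): continuum YM on T⁴ ⇐ BetaPertH ∧ nine spine estimates
(0/9 proved); BetaPertH ⇐ (D1) ∧ (D4) ∧ CAP+tail; G-an2-4 gates asym, D1 and NE2/3/4.  `FlowStep.BetaPertH`, (B), (B^μ) do not occur;
[I]∕[II] for TYPES only (ABSOLUTE RULE).  0 def, 0 sorry.  A sharper RATE inside a CONDITIONAL END is not progress on the estimate itself.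

CONTENT (composition by name; [folklore] bookkeeping):
* §1 **`ne9_and_fadingMemory_of_potentialKPG_offCentre_vac`** — E132 §5's binder list VERBATIM and in the same order, EXCEPT: `hθ0`
  dropped; the room `ωh * R₀ + τbar * (2 * B + pbar) ≤ θ * R₀` REPLACED by the split rooms `(ht : ωh * R₀ + τbar * (2 * B) ≤ t * R₀)
  (hcb : τbar * pbar ≤ cb * R₀) (hθ : cb + t = θ)` and the interval test `hμ` at `(R₀, cb·R₀, t·R₀)` ⊢
  `NE9 E W κ (prodModuli (1∕(1−θ²)·ℓ) (fun _ => μ)) ∧ FadingMemory (1∕(1−θ²)·ℓ∕μ) μ (…)`.  §1b `…_offCentre_vac_quadTest`: the test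
  supplied by idea-1's quadratic test at `(cb, t′, μ)` (`t ≤ t′`, `μ·t′ < 1`).
* §2 **`ne9_and_fadingMemory_of_potentialKPG_coupling_twoRadii_offCentre_vac`** — BOTH HALVES IN LETTERS, TWO RADII (refuter
  PRICING-NE9 v11 A-v11-1): E134 §2's binder list VERBATIM with its room read as the INNER room at `s₀` (`θ₀ < 1`, feeding only the
  occupation behind `hlast` = E134 §1 `lastCouplingLipschitz_of_couplingTwoPoint_room_sharp2` BY NAME), PLUS the outer rooms SPLIT
  at `R₀` and the interval test, `hθ0` dropped ⊢ E134's moduli `ℓ = 2·clipbar·B + 2·B∕(R₀ − s₀)·qTbar` at rate `μ` (λ*(σ = 1), not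
  λ*(σ)); the centred two-radii twin (O-v11-1, rate `θ`) is the sibling `NE9HoloFamilyTwoRadiiEnd`.
* §3 ∕ §4 **`…_offCentre_psiOf`** ∕ **`…_coupling_twoRadii_offCentre_psiOf`** — §1 ∕ §2 at `Ψ := NE9EndApplied.ΨOf` (`rfl`): THE R4♯-T
  ENDs AT THE RECORD (E132 §7's ∕ E134 §3's twins).
* §5 arithmetic `example` at the refuter's table-H letters in the record's currency (`R₀ = 1`, `t = 17∕52`, `c̄ = 1∕4`,
  `θ = 15∕26`, `μ = 44∕125 < θ`); the centred ENDs E132 §5 ∕ E134 §2 stay in the tree as landed (rate `θ`, one room) — the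
  wrapper's junction `example` (leaf-05) shows §1 ⊇ it at centres `0`.
WHAT THIS DOES NOT DO: discharge `PotentialKPG` ∕ `hexplZ` ∕ `hCup` ∕ `hTcup` ∕ the structural binders (instance = model O-NE9-1, wall
W1); choose `μ` (the instancer's `norm_num` line; the refuter's λ*(z, S) table, PRICING-NE9 v10 §E ∕ v11); move the LIFE region
(alive iff slack S > 1 — unchanged; only the rate letter moves `θ ↦ μ`).  DISGUISE TEST: composition by name over generic kernels;
nothing of Bałaban's asserted, constructed or discharged.
References (TYPES only): [Balaban1987RG1] T. Bałaban, CMP **109** (1987) 249–301 — (0.23) p. 256, (1.18) p. 263, (2.13)–(2.14) p. 268;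
[Balaban1988RG2Cluster] T. Bałaban, CMP **116** (1988) 1–22 — (1.33)–(1.36) p. 9, (2.14)–(2.15) p. 15, (2.38) p. 20, (2.40)–(2.41)
p. 21; [FV1980] T. Franzoni, E. Vesentini, North-Holland Math. Studies 40 (1980) ch. V §5; [KoteckyPreiss1986] CMP **103** (1986)
Theorem p. 492.  Summits-side NEW work (LEAN PLACEMENT RULE); imports this lineage's `NE9HoloFamilyOffCentre`, E134 and leaf-05's
`NE9FutureProfileEndOfRecordOffCentre` BY NAME; modifies nothing; 0 sorry.  Value = route R4's record ENDs re-threaded through the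
translation-aware chain (rate letter `θ ↦ μ`), NOT summit progress.
-/

noncomputable section

namespace Summit.QuantumFields.BalabanUV.T4Continuum.NE9HoloFamilyOffCentreEnd

open Metric Set ComplexConjugate
open scoped BigOperators ENNReal
open Literature.Probability.LatticeModels
open Literature.MathematicalPhysics.QuantumFieldTheory.Balaban1983to89
open Literature.MathematicalPhysics.QuantumFieldTheory.Balaban1983to89.T4OutputRate
open Literature.MathematicalPhysics.QuantumFieldTheory.Balaban1983to89.T4ActivityLipschitz
open Literature.MathematicalPhysics.QuantumFieldTheory.Balaban1983to89.T4HistoryLipschitzRecursion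
open Literature.MathematicalPhysics.QuantumFieldTheory.Balaban1983to89.T4HistoryLipschitzOuter
open Literature.MathematicalPhysics.QuantumFieldTheory.Balaban1983to89.T4HistoryLipschitzActivity
open Literature.MathematicalPhysics.QuantumFieldTheory.Balaban1983to89.T4HistoryLipschitzSegment
open Literature.MathematicalPhysics.QuantumFieldTheory.Balaban1983to89.T4HistoryLipschitzActivity (ClusterGeom)
open Summit.QuantumFields.BalabanUV.T4Continuum.NE9FutureProfileStep
open Summit.QuantumFields.BalabanUV.T4Continuum.NE9FutureProfileEnd
open Summit.QuantumFields.BalabanUV.T4Continuum.NE9ChannelRealLinear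
open Summit.QuantumFields.BalabanUV.T4Continuum.NE9SliceSpaceOfRecord
open Summit.QuantumFields.BalabanUV.T4Continuum.NE9ChannelReadingOfRecord
open Summit.QuantumFields.BalabanUV.T4Continuum.NE9ChannelReadingSharp
open Summit.QuantumFields.BalabanUV.T4Continuum.NE9TableReading
open Summit.QuantumFields.BalabanUV.T4Continuum.NE9FutureProfileRecordPrelim
open Summit.QuantumFields.BalabanUV.T4Continuum.NE9FutureProfileEndOfRecordOffCentre
open Summit.QuantumFields.BalabanUV.T4Continuum.NE9HoloSliceOfFamily
open Summit.QuantumFields.BalabanUV.T4Continuum.NE9HoloFamilyOfPencil (exists_star_clm_lp)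
open Summit.QuantumFields.BalabanUV.T4Continuum.NE9FutureProfileReal
open Summit.QuantumFields.BalabanUV.T4Continuum.NE9HoloFamilyVacuumSubtracted (psiOf_eq_vac)
open Summit.QuantumFields.BalabanUV.T4Continuum.NE9HoloFamilyPotentialKPG (vacSlice_clauses_of_potentialKPG)
open Summit.QuantumFields.BalabanUV.T4Continuum.NE9HoloFamilyOffCentre (vacSlice_offCentre_of_potentialKPG)
open Summit.QuantumFields.BalabanUV.T4Continuum.NE9HoloFamilyCoupledEndSharp2 (lastCouplingLipschitz_of_couplingTwoPoint_room_sharp2)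
open Summit.QuantumFields.BalabanUV.T4Continuum.NE9PolydiscStepOffCentre (rateIneq_of_quadTest)

variable {C : Carriers} (G : ClusterGeom C) {Bg : Type}

section Room

variable {ι : Type} [Nonempty ι] {E : Functional C Bg} {W : Set (ℕ → ℝ)} {Adm : Set (Bg → C.Dom → ℝ)}
  {T : ℕ → (ℕ → ℝ) → (Bg → C.Dom → ℝ) → ι → ℝ} {Ψ : ℕ → ℝ → (ι → ℝ) → Bg → C.Dom → ℝ}
  {κ : ℝ} {wt : ℕ → ι → ℝ} {τ : ℕ → ℕ → ℝ} {τbar ω ωh : ℝ}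

/-! ## §1 THE ♯-END OF RECORD ON `PotentialKPG` LETTERS WITH THE TRANSLATION-AWARE CHAIN (coupling half displayed as `hlast`) -/

omit G in
/-- **ROUTE R4♯-T's END OF RECORD ON THE RECORD's NEW-TERM SHAPE, TABLE HALF IN `PotentialKPG` LETTERS, OFF-CENTRE IMAGES.**
Hypotheses: E132 §5's list — structural binders (`h0`, `AdmissibleTerms`, `AdmRestrict`, `ChannelAdditive`, `ChannelLocal`,
`ChannelSizeAtStepNN` + `hτ`, `Factorises`, `LastCouplingLipschitz` + `hlam`, `hsmul`, `hne`, `hwt`, `hτbar`, `hω`∕`hωh`∕`hωωh`), the pencil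
`hKP : PotentialKPG W act m a d R₀`, `hdec`, `hpin` (budget `B`), the shape `hΨv`, `hexplZ`∕`hp₀`, `0 < R₀`, `0 ≤ B`, `0 ≤ p̄₀`, `θ < 1`,
`0 ≤ ℓ` — with the ROOM SPLIT: `ht : ω̂·R₀ + τ̄·(2B) ≤ t·R₀` (radius part), `hcb : τ̄·p̄₀ ≤ c̄·R₀` (translation part), `hθ : c̄ + t = θ`,
and a rate `μ` passing the interval test `((t·R₀)² − ρ²)·R₀ ≤ μ·(t·R₀)·(R₀² − (c̄·R₀ + ρ)²)` on `[0, t·R₀]`.  Conclusion: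
`NE9 E W κ (prodModuli ((1∕(1−θ²))·ℓ) (fun _ => μ)) ∧ FadingMemory ((1∕(1−θ²))·ℓ∕μ) μ (…)`.  Proof: (Φ-holo)∕(Φ-real) from E132 §4
(σ := Mathlib's `star`), the off-centre (Φ-size) + centre size from the (T-c) record clause, into leaf-05's
`ne9_and_fadingMemory_of_holoSlice_injRead_offCentre_split` at `r := R₀`, `τ₀ := τ̄`, `B₁ := 2B`, `cbar₀ := p̄₀`.  E132 §5 is the case
`μ = θ` up to the wrapper's junction.  «NE9 ⇐ the named binders».
[cite: Balaban1987RG1, (2.13)-(2.14) p.268; Balaban1988RG2Cluster, (2.14)-(2.15) p.15, (2.38) p.20, (2.40)-(2.41) p.21, (1.36) p.9; FV1980, ch.V §5] -/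
theorem ne9_and_fadingMemory_of_potentialKPG_offCentre_vac (G : ClusterGeom C)
    (h0 : ∀ g ∈ W, ∀ (U : Bg) (X : C.Dom), C.scale X = 0 → E g U X = 0)
    (hAdm : AdmissibleTerms E W Adm) (hres : AdmRestrict Adm) (hadd : ChannelAdditive Adm T) (hloc : ChannelLocal Adm T)
    (hstep : ChannelSizeAtStepNN Adm T κ wt τ) (hfac : Factorises E W T Ψ) {lam : ℕ → ℝ}
    (hlast : LastCouplingLipschitz E W T Ψ κ lam)
    (hsmul : ∀ (c : ℝ), ∀ H ∈ Adm, c • H ∈ Adm) (hne : Adm.Nonempty) (hwt : ∀ m y, 0 < wt m y)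
    (hτ : ∀ k j, j ≤ k → 0 ≤ τ k j ∧ τ k j ≤ τbar * ω ^ (k - j)) (hτbar : 0 < τbar) (hω : 0 ≤ ω) (hωh : 0 < ωh)
    (hωωh : ω ≤ ωh)
    {act : ℕ → ℝ → Bg → lp (fun _ : ι => ℂ) ∞ → G.P → ℂ} {m : ℕ → ℝ → Bg → G.P → ℝ} {a d : G.P → ℝ}
    {δ : C.Dom → ℝ} {U₀ : Bg} {explZ : ℕ → Bg → C.Dom → ℝ} {p₀ : ℕ → ℝ} {R₀ B pbar cb t θ μ ℓ : ℝ}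
    (hR₀ : 0 < R₀) (hB : 0 ≤ B) (hpbar : 0 ≤ pbar) (hθ1 : θ < 1) (hℓ : 0 ≤ ℓ)
    (hKP : G.PotentialKPG W act m a d R₀) (hdec : G.DecayExtract δ d) (hpin : G.PinBudget a δ (fun _ => B) κ)
    (hΨv : ∀ (k : ℕ) (s : ℝ) (P : ι → ℝ) (U : Bg) (X : C.Dom),
      Ψ k s P U X = (G.newTerm act k s U X (reading (wt k) P)).re - (G.newTerm act k s U₀ X (reading (wt k) P)).re +
        explZ k U X)
    (hexplZ : ∀ (k : ℕ) (U : Bg) (X : C.Dom), C.scale X = k + 1 → |explZ k U X| ≤ Real.exp (-(κ * C.d X)) * p₀ k)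
    (hp₀ : ∀ k, p₀ k ≤ pbar)
    (ht : ωh * R₀ + τbar * (2 * B) ≤ t * R₀) (hcb : τbar * pbar ≤ cb * R₀) (hθ : cb + t = θ)
    (hμ : ∀ ρ ∈ Icc (0 : ℝ) (t * R₀), ((t * R₀) ^ 2 - ρ ^ 2) * R₀ ≤ μ * (t * R₀) * (R₀ ^ 2 - (cb * R₀ + ρ) ^ 2))
    (hlam : ∀ k, lam k ≤ ℓ) :
    NE9 E W κ (prodModuli (1 / (1 - θ ^ 2) * ℓ) fun _ => μ) ∧
      FadingMemory (1 / (1 - θ ^ 2) * ℓ / μ) μ (prodModuli (1 / (1 - θ ^ 2) * ℓ) fun _ => μ) := by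
  obtain ⟨σ, hσa, hσ, hiso⟩ := exists_star_clm_lp (ι := ι)
  have hfixρ : ∀ (k : ℕ) (P : ι → ℝ), σ (reading (wt k) P) = reading (wt k) P := fun k P => by
    rw [hσa]; exact (isSelfAdjoint_reading (wt k) P).star_eq
  obtain ⟨hΦd, -, hreal⟩ := vacSlice_clauses_of_potentialKPG (W := W) (E := E) (T := T) (Ψ := Ψ) (κ := κ) G hσ
    hiso hfixρ hB hpbar hKP hdec hpin hΨv hexplZ hp₀
  obtain ⟨hcY, hΦoff⟩ := vacSlice_offCentre_of_potentialKPG (W := W) (κ := κ) G hσ hiso hB hpbar hKP hdec hpin hexplZ hp₀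
  exact ne9_and_fadingMemory_of_holoSlice_injRead_offCentre_split h0 hAdm hres hadd hloc hstep hfac hlast hsmul hne hwt hτ hω
    hωh hωωh hτbar (fun j n s _ => norm_RdAmb_le_geometric_sharp (τ_geom hτ) j n s) hR₀ (by positivity) hpbar hθ1 hℓ hΦd _
    hΦoff hcY hreal ht hcb hθ hμ hlam

omit G in
/-- **§1b — THE SAME END AT THE QUADRATIC TEST** (planner `t4-ne9-idea-1` gen 9; `NE9PolydiscStepOffCentre.rateIneq_of_quadTest`):
§1's binder list with the interval test REPLACED by `t ≤ t′`, `μ·t′ < 1`, `(μ·t′·c̄)² ≤ (μ·t′·(1 − c̄²) − t′²)·(1 − μ·t′)` — a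
`norm_num` line at rational letters.  «NE9 ⇐ the named binders».
[cite: Balaban1987RG1, (2.13)-(2.14) p.268; Balaban1988RG2Cluster, (2.38) p.20, (2.40)-(2.41) p.21, (1.36) p.9] -/
theorem ne9_and_fadingMemory_of_potentialKPG_offCentre_vac_quadTest (G : ClusterGeom C)
    (h0 : ∀ g ∈ W, ∀ (U : Bg) (X : C.Dom), C.scale X = 0 → E g U X = 0)
    (hAdm : AdmissibleTerms E W Adm) (hres : AdmRestrict Adm) (hadd : ChannelAdditive Adm T) (hloc : ChannelLocal Adm T)
    (hstep : ChannelSizeAtStepNN Adm T κ wt τ) (hfac : Factorises E W T Ψ) {lam : ℕ → ℝ}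
    (hlast : LastCouplingLipschitz E W T Ψ κ lam)
    (hsmul : ∀ (c : ℝ), ∀ H ∈ Adm, c • H ∈ Adm) (hne : Adm.Nonempty) (hwt : ∀ m y, 0 < wt m y)
    (hτ : ∀ k j, j ≤ k → 0 ≤ τ k j ∧ τ k j ≤ τbar * ω ^ (k - j)) (hτbar : 0 < τbar) (hω : 0 ≤ ω) (hωh : 0 < ωh)
    (hωωh : ω ≤ ωh)
    {act : ℕ → ℝ → Bg → lp (fun _ : ι => ℂ) ∞ → G.P → ℂ} {m : ℕ → ℝ → Bg → G.P → ℝ} {a d : G.P → ℝ}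
    {δ : C.Dom → ℝ} {U₀ : Bg} {explZ : ℕ → Bg → C.Dom → ℝ} {p₀ : ℕ → ℝ} {R₀ B pbar cb t t' θ μ ℓ : ℝ}
    (hR₀ : 0 < R₀) (hB : 0 ≤ B) (hpbar : 0 ≤ pbar) (hθ1 : θ < 1) (hℓ : 0 ≤ ℓ) (htt' : t ≤ t') (hlt : μ * t' < 1)
    (hquad : (μ * t' * cb) ^ 2 ≤ (μ * t' * (1 - cb ^ 2) - t' ^ 2) * (1 - μ * t'))
    (hKP : G.PotentialKPG W act m a d R₀) (hdec : G.DecayExtract δ d) (hpin : G.PinBudget a δ (fun _ => B) κ)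
    (hΨv : ∀ (k : ℕ) (s : ℝ) (P : ι → ℝ) (U : Bg) (X : C.Dom),
      Ψ k s P U X = (G.newTerm act k s U X (reading (wt k) P)).re - (G.newTerm act k s U₀ X (reading (wt k) P)).re +
        explZ k U X)
    (hexplZ : ∀ (k : ℕ) (U : Bg) (X : C.Dom), C.scale X = k + 1 → |explZ k U X| ≤ Real.exp (-(κ * C.d X)) * p₀ k)
    (hp₀ : ∀ k, p₀ k ≤ pbar)
    (ht : ωh * R₀ + τbar * (2 * B) ≤ t * R₀) (hcb : τbar * pbar ≤ cb * R₀) (hθ : cb + t = θ) (hlam : ∀ k, lam k ≤ ℓ) :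
    NE9 E W κ (prodModuli (1 / (1 - θ ^ 2) * ℓ) fun _ => μ) ∧
      FadingMemory (1 / (1 - θ ^ 2) * ℓ / μ) μ (prodModuli (1 / (1 - θ ^ 2) * ℓ) fun _ => μ) := by
  obtain ⟨σ, hσa, hσ, hiso⟩ := exists_star_clm_lp (ι := ι)
  have hfixρ : ∀ (k : ℕ) (P : ι → ℝ), σ (reading (wt k) P) = reading (wt k) P := fun k P => by
    rw [hσa]; exact (isSelfAdjoint_reading (wt k) P).star_eq
  obtain ⟨hΦd, -, hreal⟩ := vacSlice_clauses_of_potentialKPG (W := W) (E := E) (T := T) (Ψ := Ψ) (κ := κ) G hσ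
    hiso hfixρ hB hpbar hKP hdec hpin hΨv hexplZ hp₀
  obtain ⟨hcY, hΦoff⟩ := vacSlice_offCentre_of_potentialKPG (W := W) (κ := κ) G hσ hiso hB hpbar hKP hdec hpin hexplZ hp₀
  exact ne9_and_fadingMemory_of_holoSlice_injRead_offCentre_quadTest h0 hAdm hres hadd hloc hstep hfac hlast hsmul hne hwt hτ hω
    hωh hωωh hτbar (fun j n s _ => norm_RdAmb_le_geometric_sharp (τ_geom hτ) j n s) hR₀ (by positivity) hpbar hθ1 hℓ htt' hlt
    hquad hΦd _ hΦoff hcY hreal ht hcb hθ hlam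

/-! ## §2 BOTH HALVES IN LETTERS, TWO RADII (refuter A-v11-1): §1 on `‖Q‖ < R₀` with `hlast :=` E134 §1 on `‖Q‖ < s₀` -/

/-- **ROUTE R4♯-T's END OF RECORD, BOTH HALVES IN LETTERS, TWO RADII, OFF-CENTRE IMAGES.**  E134 §2's
hypotheses VERBATIM (structural binders; `hKP` + `hkp2` + `hdec` + `hpin`; `hΨv`; `hexplZ`∕`hp₀`; `hCup` on `ball 0 s₀`, `hclip0`∕`hclipb`;
`hTcup`, `hqT0`∕`hqTb`; `0 < s₀ < R₀`) with its room READ AS THE INNER ROOM `hroom₀ : ωh * s₀ + τbar * (2 * B + pbar) ≤ θ₀ * s₀` (`θ₀ < 1`;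
it feeds ONLY the occupation behind `hlast`, E134 §1), PLUS the OUTER room SPLIT
at `R₀` — `ht : ωh * R₀ + τbar * (2 * B) ≤ t * R₀` (radius part), `hcb : τbar * pbar ≤ cb * R₀` (translation part), `hθ : cb + t = θ`
(`θ < 1`; `hθ0` dropped) — and a rate `μ` passing the interval test `((t·R₀)² − ρ²)·R₀ ≤ μ·(t·R₀)·(R₀² − (cb·R₀ + ρ)²)` on `[0, t·R₀]`.
Conclusion: E134 §2's moduli at rate `μ` (least admissible = λ*(σ = 1) of
PRICING-NE9 v10 §E ∕ v11 table L), prefactor `1∕(1−θ²)`.  Proof: `hlast` by E134 §1 at the inner room; then §1.  «NE9 ⇐ the named binders».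
[cite: Balaban1987RG1, (2.13)-(2.14) p.268 and p.263 (1.18); Balaban1988RG2Cluster, (1.33)-(1.36) p.9, (2.14)-(2.15) p.15, (2.38) p.20, (2.40)-(2.41) p.21; FV1980, ch.V §5] -/
theorem ne9_and_fadingMemory_of_potentialKPG_coupling_twoRadii_offCentre_vac
    (h0 : ∀ g ∈ W, ∀ (U : Bg) (X : C.Dom), C.scale X = 0 → E g U X = 0)
    (hAdm : AdmissibleTerms E W Adm) (hres : AdmRestrict Adm) (hadd : ChannelAdditive Adm T) (hloc : ChannelLocal Adm T)
    (hstep : ChannelSizeAtStepNN Adm T κ wt τ) (hfac : Factorises E W T Ψ)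
    (hsmul : ∀ (c : ℝ), ∀ H ∈ Adm, c • H ∈ Adm) (hne : Adm.Nonempty) (hwt : ∀ m y, 0 < wt m y)
    (hτ : ∀ k j, j ≤ k → 0 ≤ τ k j ∧ τ k j ≤ τbar * ω ^ (k - j)) (hτbar : 0 < τbar) (hω : 0 ≤ ω) (hωh : 0 < ωh)
    (hωωh : ω ≤ ωh)
    {act : ℕ → ℝ → Bg → lp (fun _ : ι => ℂ) ∞ → G.P → ℂ} {m : ℕ → ℝ → Bg → G.P → ℝ} {a d : G.P → ℝ}
    {δ : C.Dom → ℝ} {U₀ : Bg} {explZ : ℕ → Bg → C.Dom → ℝ} {p₀ clip qT : ℕ → ℝ}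
    {R₀ s₀ B pbar θ₀ cb t θ μ clipbar qTbar : ℝ}
    (hs₀ : 0 < s₀) (hsR : s₀ < R₀) (hB : 0 ≤ B) (hpbar : 0 ≤ pbar) (hθ₀1 : θ₀ < 1) (hθ1 : θ < 1)
    (hKP : G.PotentialKPG W act m a d R₀)
    (hkp2 : ∀ g ∈ W, ∀ (k : ℕ) (U : Bg) (X : C.Dom), C.scale X = k + 1 →
      ∀ γ ∈ G.vol X, ∑ γ' ∈ G.vol X with G.inc γ' γ, 2 * m k (g k) U γ' * Real.exp (a γ' + d γ') ≤ a γ)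
    (hdec : G.DecayExtract δ d) (hpin : G.PinBudget a δ (fun _ => B) κ)
    (hΨv : ∀ (k : ℕ) (s : ℝ) (P : ι → ℝ) (U : Bg) (X : C.Dom),
      Ψ k s P U X = (G.newTerm act k s U X (reading (wt k) P)).re - (G.newTerm act k s U₀ X (reading (wt k) P)).re +
        explZ k U X)
    (hexplZ : ∀ (k : ℕ) (U : Bg) (X : C.Dom), C.scale X = k + 1 → |explZ k U X| ≤ Real.exp (-(κ * C.d X)) * p₀ k)
    (hp₀ : ∀ k, p₀ k ≤ pbar) (hclip0 : ∀ k, 0 ≤ clip k) (hclipb : ∀ k, clip k ≤ clipbar)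
    (hCup : ∀ g ∈ W, ∀ g' ∈ W, ∀ (k : ℕ) (U : Bg) (X : C.Dom), C.scale X = k + 1 →
      ∀ Q ∈ ball (0 : lp (fun _ : ι => ℂ) ∞) s₀, ∀ γ ∈ G.vol X,
        ‖act k (g k) U Q γ‖ ≤ m k (g' k) U γ ∧
          ‖act k (g k) U Q γ - act k (g' k) U Q γ‖ ≤ clip k * |g k - g' k| * m k (g' k) U γ)
    (hqT0 : ∀ k, 0 ≤ qT k) (hqTb : ∀ k, qT k ≤ qTbar)
    (hTcup : ∀ g ∈ W, ∀ g' ∈ W, ∀ (k : ℕ) (y : ι), |T k g (E g) y - T k g' (E g) y| ≤ wt k y * (qT k * |g k - g' k|))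
    (hroom₀ : ωh * s₀ + τbar * (2 * B + pbar) ≤ θ₀ * s₀)
    (ht : ωh * R₀ + τbar * (2 * B) ≤ t * R₀) (hcb : τbar * pbar ≤ cb * R₀) (hθ : cb + t = θ)
    (hμ : ∀ ρ ∈ Icc (0 : ℝ) (t * R₀), ((t * R₀) ^ 2 - ρ ^ 2) * R₀ ≤ μ * (t * R₀) * (R₀ ^ 2 - (cb * R₀ + ρ) ^ 2)) :
    NE9 E W κ (prodModuli (1 / (1 - θ ^ 2) * (2 * clipbar * B + 2 * B / (R₀ - s₀) * qTbar)) fun _ => μ) ∧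
      FadingMemory (1 / (1 - θ ^ 2) * (2 * clipbar * B + 2 * B / (R₀ - s₀) * qTbar) / μ) μ
        (prodModuli (1 / (1 - θ ^ 2) * (2 * clipbar * B + 2 * B / (R₀ - s₀) * qTbar)) fun _ => μ) := by
  have hlast := lastCouplingLipschitz_of_couplingTwoPoint_room_sharp2 G h0 hAdm hres hadd hloc hstep hfac hsmul hne hwt hτ hτbar
    hω hωh hωωh hs₀ hsR hB hpbar hθ₀1 hKP hkp2 hdec hpin hΨv hexplZ hp₀ hclip0 hCup hqT0 hTcup hroom₀
  have hϱ : 0 < R₀ - s₀ := sub_pos.mpr hsR; have hclipbar : 0 ≤ clipbar := (hclip0 0).trans (hclipb 0)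
  have hqTbar : 0 ≤ qTbar := (hqT0 0).trans (hqTb 0); have hc : 0 ≤ 2 * B / (R₀ - s₀) := by positivity
  have hℓ : 0 ≤ 2 * clipbar * B + 2 * B / (R₀ - s₀) * qTbar := by positivity
  have hlam : ∀ k, 2 * clip k * B + 2 * B / (R₀ - s₀) * qT k ≤ 2 * clipbar * B + 2 * B / (R₀ - s₀) * qTbar := fun k =>
    add_le_add (by gcongr; exact hclipb k) (mul_le_mul_of_nonneg_left (hqTb k) hc)
  exact ne9_and_fadingMemory_of_potentialKPG_offCentre_vac G h0 hAdm hres hadd hloc hstep hfac hlast hsmul hne hwt hτ hτbar hω hωh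
    hωωh (hs₀.trans hsR) hB hpbar hθ1 hℓ hKP hdec hpin hΨv hexplZ hp₀ ht hcb hθ hμ hlam

end Room

/-! ## §3 ∕ §4 At the record's own new-term map `NE9EndApplied.ΨOf` (shape by `rfl`) -/

section Record

open Summit.QuantumFields.BalabanUV.T4Continuum.NE9EndApplied
open Summit.QuantumFields.BalabanUV.T4Continuum.NE9ComplexEncoding (doubleCarriers)

variable {C₀ : Carriers} {E : Type} {ι : Type}

omit G in
/-- **§3 — ROUTE R4♯-T's END AT THE RECORD's OWN NEW-TERM MAP `ΨOf`, TABLE HALF ON `PotentialKPG`, `hlast` DISPLAYED** — §1 at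
`Ψ := NE9EndApplied.ΨOf G act wt U₀ explZ` (`hΨv` by `psiOf_eq_vac`, `rfl`); E132 §7's twin with the split rooms and the rate `μ`.
«NE9 ⇐ the named binders». [cite: Balaban1987RG1, (2.13)-(2.14) p.268 and (0.23) p.256; Balaban1988RG2Cluster, (2.38) p.20, (2.40)-(2.41) p.21; FV1980, ch.V §5] -/
theorem ne9_and_fadingMemory_of_potentialKPG_offCentre_psiOf [Nonempty ι] (G : ClusterGeom (doubleCarriers C₀))
    {Ef : Functional (doubleCarriers C₀) E} {W : Set (ℕ → ℝ)} {Adm : Set (E → (doubleCarriers C₀).Dom → ℝ)}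
    {T : ℕ → (ℕ → ℝ) → (E → (doubleCarriers C₀).Dom → ℝ) → ι → ℝ} {κ : ℝ} {wt : ℕ → ι → ℝ} {τ : ℕ → ℕ → ℝ}
    {τbar ω ωh : ℝ} {act : ℕ → ℝ → E → lp (fun _ : ι => ℂ) ∞ → G.P → ℂ} {U₀ : E}
    {explZ : ℕ → E → (doubleCarriers C₀).Dom → ℝ}
    (h0 : ∀ g ∈ W, ∀ (U : E) (X : (doubleCarriers C₀).Dom), (doubleCarriers C₀).scale X = 0 → Ef g U X = 0)
    (hAdm : AdmissibleTerms Ef W Adm) (hres : AdmRestrict Adm) (hadd : ChannelAdditive Adm T) (hloc : ChannelLocal Adm T)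
    (hstep : ChannelSizeAtStepNN Adm T κ wt τ) (hfac : Factorises Ef W T (ΨOf G act wt U₀ explZ)) {lam : ℕ → ℝ}
    (hlast : LastCouplingLipschitz Ef W T (ΨOf G act wt U₀ explZ) κ lam)
    (hsmul : ∀ (c : ℝ), ∀ H ∈ Adm, c • H ∈ Adm) (hne : Adm.Nonempty) (hwt : ∀ m y, 0 < wt m y)
    (hτ : ∀ k j, j ≤ k → 0 ≤ τ k j ∧ τ k j ≤ τbar * ω ^ (k - j)) (hτbar : 0 < τbar) (hω : 0 ≤ ω) (hωh : 0 < ωh)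
    (hωωh : ω ≤ ωh) {m : ℕ → ℝ → E → G.P → ℝ} {a d : G.P → ℝ} {δ : (doubleCarriers C₀).Dom → ℝ} {p₀ : ℕ → ℝ}
    {R₀ B pbar cb t θ μ ℓ : ℝ} (hR₀ : 0 < R₀) (hB : 0 ≤ B) (hpbar : 0 ≤ pbar) (hθ1 : θ < 1) (hℓ : 0 ≤ ℓ)
    (hKP : G.PotentialKPG W act m a d R₀) (hdec : G.DecayExtract δ d) (hpin : G.PinBudget a δ (fun _ => B) κ)
    (hexplZ : ∀ (k : ℕ) (U : E) (X : (doubleCarriers C₀).Dom), (doubleCarriers C₀).scale X = k + 1 →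
      |explZ k U X| ≤ Real.exp (-(κ * (doubleCarriers C₀).d X)) * p₀ k)
    (hp₀ : ∀ k, p₀ k ≤ pbar)
    (ht : ωh * R₀ + τbar * (2 * B) ≤ t * R₀) (hcb : τbar * pbar ≤ cb * R₀) (hθ : cb + t = θ)
    (hμ : ∀ ρ ∈ Icc (0 : ℝ) (t * R₀), ((t * R₀) ^ 2 - ρ ^ 2) * R₀ ≤ μ * (t * R₀) * (R₀ ^ 2 - (cb * R₀ + ρ) ^ 2))
    (hlam : ∀ k, lam k ≤ ℓ) :
    NE9 Ef W κ (prodModuli (1 / (1 - θ ^ 2) * ℓ) fun _ => μ) ∧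
      FadingMemory (1 / (1 - θ ^ 2) * ℓ / μ) μ (prodModuli (1 / (1 - θ ^ 2) * ℓ) fun _ => μ) :=
  ne9_and_fadingMemory_of_potentialKPG_offCentre_vac G h0 hAdm hres hadd hloc hstep hfac hlast hsmul hne hwt hτ hτbar hω hωh hωωh
    hR₀ hB hpbar hθ1 hℓ hKP hdec hpin (fun k s Q U X => psiOf_eq_vac G act wt U₀ explZ k s Q U X) hexplZ hp₀ ht hcb hθ hμ hlam

omit G in
/-- **§4 — ROUTE R4♯-T's END AT THE RECORD's OWN NEW-TERM MAP `ΨOf`, BOTH HALVES IN LETTERS, TWO RADII, OFF-CENTRE IMAGES** — §2 at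
`Ψ := NE9EndApplied.ΨOf G act wt U₀ explZ` (`rfl`): THE R4♯-T END AT THE RECORD WITH BOTH HALVES IN LETTERS.  Inner room at `s₀` (`θ₀`); outer rooms split at `R₀`
(`t`, `cb`, `θ = cb + t`); rate `μ` by the interval test.  «NE9 ⇐ the named binders»; nothing of Bałaban's asserted.
[cite: Balaban1987RG1, (2.13)-(2.14) p.268 and (0.23) p.256, p.263; Balaban1988RG2Cluster, (1.33)-(1.36) p.9, (2.38) p.20, (2.40)-(2.41) p.21; FV1980, ch.V §5] -/
theorem ne9_and_fadingMemory_of_potentialKPG_coupling_twoRadii_offCentre_psiOf [Nonempty ι]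
    (G : ClusterGeom (doubleCarriers C₀))
    {Ef : Functional (doubleCarriers C₀) E} {W : Set (ℕ → ℝ)} {Adm : Set (E → (doubleCarriers C₀).Dom → ℝ)}
    {T : ℕ → (ℕ → ℝ) → (E → (doubleCarriers C₀).Dom → ℝ) → ι → ℝ} {κ : ℝ} {wt : ℕ → ι → ℝ} {τ : ℕ → ℕ → ℝ}
    {τbar ω ωh : ℝ} {act : ℕ → ℝ → E → lp (fun _ : ι => ℂ) ∞ → G.P → ℂ} {U₀ : E}
    {explZ : ℕ → E → (doubleCarriers C₀).Dom → ℝ}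
    (h0 : ∀ g ∈ W, ∀ (U : E) (X : (doubleCarriers C₀).Dom), (doubleCarriers C₀).scale X = 0 → Ef g U X = 0)
    (hAdm : AdmissibleTerms Ef W Adm) (hres : AdmRestrict Adm) (hadd : ChannelAdditive Adm T) (hloc : ChannelLocal Adm T)
    (hstep : ChannelSizeAtStepNN Adm T κ wt τ) (hfac : Factorises Ef W T (ΨOf G act wt U₀ explZ))
    (hsmul : ∀ (c : ℝ), ∀ H ∈ Adm, c • H ∈ Adm) (hne : Adm.Nonempty) (hwt : ∀ m y, 0 < wt m y)
    (hτ : ∀ k j, j ≤ k → 0 ≤ τ k j ∧ τ k j ≤ τbar * ω ^ (k - j)) (hτbar : 0 < τbar) (hω : 0 ≤ ω) (hωh : 0 < ωh)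
    (hωωh : ω ≤ ωh) {m : ℕ → ℝ → E → G.P → ℝ} {a d : G.P → ℝ} {δ : (doubleCarriers C₀).Dom → ℝ}
    {p₀ clip qT : ℕ → ℝ} {R₀ s₀ B pbar θ₀ cb t θ μ clipbar qTbar : ℝ}
    (hs₀ : 0 < s₀) (hsR : s₀ < R₀) (hB : 0 ≤ B) (hpbar : 0 ≤ pbar) (hθ₀1 : θ₀ < 1) (hθ1 : θ < 1)
    (hKP : G.PotentialKPG W act m a d R₀)
    (hkp2 : ∀ g ∈ W, ∀ (k : ℕ) (U : E) (X : (doubleCarriers C₀).Dom), (doubleCarriers C₀).scale X = k + 1 →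
      ∀ γ ∈ G.vol X, ∑ γ' ∈ G.vol X with G.inc γ' γ, 2 * m k (g k) U γ' * Real.exp (a γ' + d γ') ≤ a γ)
    (hdec : G.DecayExtract δ d) (hpin : G.PinBudget a δ (fun _ => B) κ)
    (hexplZ : ∀ (k : ℕ) (U : E) (X : (doubleCarriers C₀).Dom), (doubleCarriers C₀).scale X = k + 1 →
      |explZ k U X| ≤ Real.exp (-(κ * (doubleCarriers C₀).d X)) * p₀ k)
    (hp₀ : ∀ k, p₀ k ≤ pbar) (hclip0 : ∀ k, 0 ≤ clip k) (hclipb : ∀ k, clip k ≤ clipbar)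
    (hCup : ∀ g ∈ W, ∀ g' ∈ W, ∀ (k : ℕ) (U : E) (X : (doubleCarriers C₀).Dom), (doubleCarriers C₀).scale X = k + 1 →
      ∀ Q ∈ ball (0 : lp (fun _ : ι => ℂ) ∞) s₀, ∀ γ ∈ G.vol X,
        ‖act k (g k) U Q γ‖ ≤ m k (g' k) U γ ∧
          ‖act k (g k) U Q γ - act k (g' k) U Q γ‖ ≤ clip k * |g k - g' k| * m k (g' k) U γ)
    (hqT0 : ∀ k, 0 ≤ qT k) (hqTb : ∀ k, qT k ≤ qTbar)
    (hTcup : ∀ g ∈ W, ∀ g' ∈ W, ∀ (k : ℕ) (y : ι),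
      |T k g (Ef g) y - T k g' (Ef g) y| ≤ wt k y * (qT k * |g k - g' k|))
    (hroom₀ : ωh * s₀ + τbar * (2 * B + pbar) ≤ θ₀ * s₀)
    (ht : ωh * R₀ + τbar * (2 * B) ≤ t * R₀) (hcb : τbar * pbar ≤ cb * R₀) (hθ : cb + t = θ)
    (hμ : ∀ ρ ∈ Icc (0 : ℝ) (t * R₀), ((t * R₀) ^ 2 - ρ ^ 2) * R₀ ≤ μ * (t * R₀) * (R₀ ^ 2 - (cb * R₀ + ρ) ^ 2)) :
    NE9 Ef W κ (prodModuli (1 / (1 - θ ^ 2) * (2 * clipbar * B + 2 * B / (R₀ - s₀) * qTbar)) fun _ => μ) ∧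
      FadingMemory (1 / (1 - θ ^ 2) * (2 * clipbar * B + 2 * B / (R₀ - s₀) * qTbar) / μ) μ
        (prodModuli (1 / (1 - θ ^ 2) * (2 * clipbar * B + 2 * B / (R₀ - s₀) * qTbar)) fun _ => μ) :=
  ne9_and_fadingMemory_of_potentialKPG_coupling_twoRadii_offCentre_vac G h0 hAdm hres hadd hloc hstep hfac hsmul hne hwt hτ hτbar
    hω hωh hωωh hs₀ hsR hB hpbar hθ₀1 hθ1 hKP hkp2 hdec hpin (fun k s Q U X => psiOf_eq_vac G act wt U₀ explZ k s Q U X) hexplZ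
    hp₀ hclip0 hclipb hCup hqT0 hqTb hTcup hroom₀ ht hcb hθ hμ

end Record

/-! ## §5 Arithmetic at the refuter's table-H letters on the record's currency (pure numbers, asserted of nothing) -/

/-- ARITHMETIC (PRICING-NE9 v10 (E10-2)∕§E, pure numbers, the record's currency `R₀ = 1`): radius part `t = ω̂ + τ̄·2B = 17∕52`,
translation part `c̄ = τ̄·p̄₀ = 1∕4`, `θ = c̄ + t = 15∕26` — the SAME total room as E132∕E134 (`ω̂·1 + τ̄·(2B + p̄₀) = θ·1`); the rate
`μ = 44∕125` passes §1's interval test, `μ < θ`.  A READING of [II] p. 21 ∕ p. 8 l. 9–10, asserted of nothing. [folklore] -/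
example : (∀ ρ ∈ Icc (0 : ℝ) (17 / 52 * 1),
    ((17 / 52 * 1 : ℝ) ^ 2 - ρ ^ 2) * 1 ≤ 44 / 125 * (17 / 52 * 1) * (1 ^ 2 - (1 / 4 * 1 + ρ) ^ 2)) ∧
    (1 : ℝ) / 4 + 17 / 52 = 15 / 26 ∧ (44 : ℝ) / 125 < 15 / 26 := by
  refine ⟨fun ρ hρ => ?_, by norm_num, by norm_num⟩
  nlinarith [sq_nonneg (ρ - 13 / 400), hρ.1, hρ.2]

end Summit.QuantumFields.BalabanUV.T4Continuum.NE9HoloFamilyOffCentreEnd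

end
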